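import Literature.Geometry.Kaehler.ComplexTorusEffectiveClassesFiniteProduct
import Literature.Geometry.Kaehler.ComplexTorusMaximalPicardNumber
import HarnessLib

/-!
# Bauer 1998, §4: "by Gordan's Lemma this is equivalent to the semi-group `N(X)` being finitely
# generated" — `Nef(X)` is rational polyhedral iff `N(X)` is finitely generated; Thm. 4.2 for the nef cone

Layer `Literature/Geometry/Kaehler`, namespace `Literature.Geometry.Kaehler.ComplexTorus`; lane
`lit-hodgefound`, seat p07 (generation 44), programme «THE NEF CONE OF AN ABELIAN VARIETY», file 55 of the
seat lineage; sequel of `ComplexTorusNefConePolyhedralSimple` (file 50: (ib) ⟺ (ic) ⟺ (ii) for a SIMPLE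
abelian variety; the closedness of finitely generated cones of semi-positive forms
`isClosed_span_nnreal_of_forall_semipos`; clearing denominators `exists_pos_isNSForm_nat_cast_smul_of_mem_span_rat`),
`ComplexTorusEffectiveClassesFiniteProduct` (file 54: Thm. 4.2 for the semigroup `N(X)`, (ic) ⟺ (ii) along a
Poincaré decomposition) and `ComplexTorusMaximalPicardNumber` (`linearIndependent_real_neronSeveriGroup_basis`:
a `ℤ`-basis of `NS(X)` is `ℝ`-independent), all consumed BY NAME.  Theorems only (no definition, no named
fact, no instance, no notation; net debt `0`).

THE SOURCE (Th. Bauer, *On the cone of curves of an abelian variety*, Amer. J. Math. 120 (1998); held arXiv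
alg-geom/9712019), VERBATIM. §1 Theorem: "the following conditions are equivalent: (ia) The closed cone of
curves `NE̅(X)` is rational polyhedral. (ib) The nef cone `Nef(X)` is rational polyhedral. (ic) The
semi-group `N(X)` is finitely generated. (ii) `X` is isogenous to a product `X₁ × … × X_r` of mutually
non-isogenous abelian varieties `Xᵢ` with `NS(Xᵢ) ≅ ℤ`. […] since on abelian varieties the nef cone
coincides with the effective cone, the equivalence of (ia), (ib) and (ic) follows from elementary
properties of cones" (p. 2); §4: "The dual of `Nef(X)` in turn is the closed cone `NE̅(X)`, so that one of
these two cones is rational polyhedral if and only if the other is. By Gordon's Lemma this is equivalent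
to the semi-group `N(X)` being finitely generated. (See e.g. [Roc70] for the elementary properties of
cones used here)." (p. 5).

THIS FILE, in the tree's model (`NS(X) = {IsNSForm}`, `NS_ℝ(X) = span_ℝ NS(X)`,
`Nef(X) = {θ ∈ NS_ℝ(X) | H_θ ≥ 0}`, `N(X) = {η ∈ NS(X) | H_η ≥ 0}`; "rational polyhedral" = the convex cone
`Σ ℝ≥0·sᵢ` of finitely many classes `sᵢ ∈ NS(X)`, as in files 50 and 52):
* §1 **(ib) ⟹ (ic), for every complex torus** (`exists_finset_addSubmonoidClosure_eq_of_span_nnreal_eq`):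
  GORDAN'S LEMMA in the form needed — if `Nef(X) = Σᵢ ℝ≥0·sᵢ` with `sᵢ ∈ NS(X)` then
  `N(X) = Nef(X) ∩ NS(X)` is generated by the finitely many lattice points `Σ μᵢsᵢ ∈ NS(X)`, `0 ≤ μᵢ ≤ 1`,
  of the fundamental parallelepiped (`η = Σ ⌊λᵢ⌋sᵢ + Σ (λᵢ − ⌊λᵢ⌋)sᵢ`; finiteness through the integer
  coordinates in a `ℤ`-basis of `NS(X)`, which is `ℝ`-independent) [the argument of Schrijver, *Theory of
  linear and integer programming*, Thm. 16.4, cf. `Literature/Combinatorics/Optimization/HilbertBasis`, here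
  for the lattice `NS(X) ⊂ NS_ℝ(X)`].
* §2 **(ic) ⟹ (ib), for abelian varieties** (`IsAbelianVariety.exists_finset_span_nnreal_eq_of_addSubmonoidClosure_eq`):
  if `N(X)` is generated by `S` then `Nef(X) = Σ_{s ∈ S∖0} ℝ≥0·s` — a nef real class `θ` is a limit of
  positive multiples of ample `ℚ`-classes `Σⱼ rⱼbⱼ + tM` (`M` ample, `bⱼ` a `ℤ`-basis of `NS(X)`, openness of
  positivity `exists_pos_forall_add_smul_apply_I_smul_self_pos`), which lie in `ℝ≥0·N(X)`, and the finitely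
  generated cone is closed; with §1 **(ib) ⟺ (ic)**
  (`IsAbelianVariety.exists_finset_span_nnreal_eq_iff_exists_finset_addSubmonoidClosure_eq`).  The approximation
  itself is `IsAbelianVariety.exists_mem_span_rat_forall_pos_dist_lt` (Debarre 1.28: a nef class is a limit of
  ample `ℚ`-classes) and gives **`IsAbelianVariety.setOf_nef_eq_closure_setOf_pos_mem_span_rat`**: the nef
  cone is the CLOSURE OF THE AMPLE `ℚ`-CLASSES (Kleiman).
* §3 Thm. 4.2 FOR THE NEF CONE ((ib) ⟺ (ii)): `IsIsogenous.exists_finset_span_nnreal_eq_iff` (Lemma 4.1 for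
  `Nef`), `IsSimple.exists_finset_span_nnreal_eq_sigmaPi_iff`, and AS PRINTED along a Poincaré
  decomposition `IsAbelianVariety.exists_finset_span_nnreal_eq_iff_of_isIsogenous_powers` — the (ib)
  versions of file 54, by §2.

## References

* [Bauer1998ConeOfCurves] Th. Bauer, *On the cone of curves of an abelian variety*, Amer. J. Math. 120 (1998)
  997–1006, §1 Theorem ((ib) ⟺ (ic) ⟺ (ii)), §4 (Gordan's lemma; Thm. 4.2) (held: arXiv alg-geom/9712019,
  pp. 2, 5).
* [Schrijver1986] A. Schrijver, *Theory of Linear and Integer Programming*, Wiley 1986, §16.4 Thm. 16.4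
  (Gordan; the parallelepiped argument).
* [Debarre2001] O. Debarre, *Higher-Dimensional Algebraic Geometry*, Universitext, Springer 2001, §1.7 (the
  ample cone and its closure) and 1.28 (nef `ℝ`-divisors: a nef class is a limit of ample `ℚ`-classes).
* [Lange2023AbelianVarietiesComplex] H. Lange, *Abelian Varieties over the Complex Numbers*, Springer 2023,
  §2.4.4 Thm. 2.4.25 (Poincaré decomposition).
-/

noncomputable section

open scoped Manifold ComplexOrder NNReal
open Complex Set Function Module Filter Topology

namespace Literature.Geometry.Kaehler

namespace ComplexTorus

/-! ### §1 Gordan's lemma for `N(X) = Nef(X) ∩ NS(X)`: (ib) ⟹ (ic), for every complex torus -/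

section Gordan

variable {ι : Type*} [Fintype ι] {E : Type*} [NormedAddCommGroup E] [NormedSpace ℂ E]
  (Φ : (ι → ℝ) ≃L[ℝ] E)

omit [Fintype ι] in
/-- Coordinates in a `ℤ`-basis of `NS(X)`, read on the real `2`-forms: `x = Σⱼ xⱼ bⱼ`. [folklore] -/
private theorem coe_eq_sum_equivFun_smul {n : ℕ} (b : Basis (Fin n) ℤ (neronSeveriGroup Φ))
    (x : neronSeveriGroup Φ) :
    (x : E [⋀^Fin 2]→L[ℝ] ℝ) = ∑ j, ((b.equivFun x j : ℤ) : ℝ) • ((b j : neronSeveriGroup Φ) : E [⋀^Fin 2]→L[ℝ] ℝ) := by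
  conv_lhs => rw [← b.sum_equivFun x]
  rw [AddSubgroup.val_finsetSum]
  refine Finset.sum_congr rfl fun j _ ↦ ?_
  rw [AddSubgroup.coe_zsmul]
  exact (Int.cast_smul_eq_zsmul ℝ _ _).symm

/-- **Lattice points of the parallelepiped have bounded coordinates**: if `p ∈ NS(X)` is a real combination
`p = Σ_{s ∈ S} μ_s s` of classes `s ∈ NS(X)`, then its `j`-th coordinate in a `ℤ`-basis `b` of `NS(X)` is
`Σ_s μ_s · (s)_j` (the `bⱼ` are `ℝ`-independent), hence `|p_j| ≤ Σ_s |s_j|` when `|μ_s| ≤ 1`.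
[cite: Schrijver1986, §16.4 Thm. 16.4 (proof, (15)–(17))] -/
private theorem abs_equivFun_le_of_eq_sum_smul {n : ℕ} (b : Basis (Fin n) ℤ (neronSeveriGroup Φ))
    (S : Finset (E [⋀^Fin 2]→L[ℝ] ℝ)) (B : (E [⋀^Fin 2]→L[ℝ] ℝ) → neronSeveriGroup Φ)
    (hB : ∀ s ∈ S, ((B s : neronSeveriGroup Φ) : E [⋀^Fin 2]→L[ℝ] ℝ) = s) {μ : (E [⋀^Fin 2]→L[ℝ] ℝ) → ℝ}
    (hμ : ∀ s ∈ S, |μ s| ≤ 1) {p : neronSeveriGroup Φ}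
    (hp : (p : E [⋀^Fin 2]→L[ℝ] ℝ) = ∑ s ∈ S, μ s • s) (j : Fin n) :
    |b.equivFun p j| ≤ ∑ s ∈ S, |b.equivFun (B s) j| := by
  have hli := linearIndependent_real_neronSeveriGroup_basis Φ b
  -- the coordinate identity `p_j = Σ_s μ_s (B s)_j`
  have hcoord : ((b.equivFun p j : ℤ) : ℝ) = ∑ s ∈ S, μ s * ((b.equivFun (B s) j : ℤ) : ℝ) := by
    have hzero : ∑ i, (((b.equivFun p i : ℤ) : ℝ) - ∑ s ∈ S, μ s * ((b.equivFun (B s) i : ℤ) : ℝ)) •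
        ((b i : neronSeveriGroup Φ) : E [⋀^Fin 2]→L[ℝ] ℝ) = 0 := by
      ext v
      have h1 := congrArg (fun f : E [⋀^Fin 2]→L[ℝ] ℝ ↦ f v) (coe_eq_sum_equivFun_smul Φ b p)
      have h2 : ∀ s ∈ S, s v = ∑ i, ((b.equivFun (B s) i : ℤ) : ℝ) *
          ((b i : neronSeveriGroup Φ) : E [⋀^Fin 2]→L[ℝ] ℝ) v := fun s hs ↦ by
        have h := congrArg (fun f : E [⋀^Fin 2]→L[ℝ] ℝ ↦ f v) (coe_eq_sum_equivFun_smul Φ b (B s))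
        simpa only [hB s hs, ContinuousAlternatingMap.sum_apply, ContinuousAlternatingMap.smul_apply,
          smul_eq_mul] using h
      simp only [hp, ContinuousAlternatingMap.sum_apply, ContinuousAlternatingMap.smul_apply, smul_eq_mul] at h1
      have h3 : ∑ s ∈ S, μ s * s v = ∑ s ∈ S, μ s * ∑ i, ((b.equivFun (B s) i : ℤ) : ℝ) *
          ((b i : neronSeveriGroup Φ) : E [⋀^Fin 2]→L[ℝ] ℝ) v :=
        Finset.sum_congr rfl fun s hs ↦ by rw [h2 s hs]
      simp only [ContinuousAlternatingMap.sum_apply, ContinuousAlternatingMap.smul_apply, smul_eq_mul,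
        ContinuousAlternatingMap.coe_zero, Pi.zero_apply, sub_mul, Finset.sum_sub_distrib]
      rw [← h1, h3, sub_eq_zero]
      simp only [Finset.mul_sum, Finset.sum_mul, mul_assoc]
      rw [Finset.sum_comm]
    exact sub_eq_zero.1 ((Fintype.linearIndependent_iff.1 hli) _ hzero j)
  have hR : |((b.equivFun p j : ℤ) : ℝ)| ≤ ∑ s ∈ S, |((b.equivFun (B s) j : ℤ) : ℝ)| := by
    rw [hcoord]
    refine (Finset.abs_sum_le_sum_abs _ _).trans (Finset.sum_le_sum fun s hs ↦ ?_)
    rw [abs_mul]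
    calc |μ s| * |((b.equivFun (B s) j : ℤ) : ℝ)| ≤ 1 * |((b.equivFun (B s) j : ℤ) : ℝ)| :=
          mul_le_mul_of_nonneg_right (hμ s hs) (abs_nonneg _)
      _ = |((b.equivFun (B s) j : ℤ) : ℝ)| := one_mul _
  have hR' : ((|b.equivFun p j| : ℤ) : ℝ) ≤ ((∑ s ∈ S, |b.equivFun (B s) j| : ℤ) : ℝ) := by
    rw [Int.cast_abs, Int.cast_sum]
    refine hR.trans (le_of_eq (Finset.sum_congr rfl fun s _ ↦ ?_))
    rw [Int.cast_abs]
  exact_mod_cast hR'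

/-- **(ib) ⟹ (ic) — Gordan's lemma for the effective classes**: if the nef cone
`Nef(X) = {θ ∈ NS_ℝ(X) | H_θ ≥ 0}` is the convex cone generated by finitely many classes `s ∈ S ⊆ NS(X)`
("rational polyhedral"), then the semigroup `N(X) = Nef(X) ∩ NS(X)` of effective (= semi-positive) classes is
finitely generated — by the lattice points `Σ μ_s s ∈ NS(X)`, `0 ≤ μ_s ≤ 1`, of the parallelepiped, which are
finitely many: `η = Σ λ_s s = Σ ⌊λ_s⌋ s + Σ (λ_s − ⌊λ_s⌋) s`. For every complex torus.
[cite: Bauer1998ConeOfCurves, §4 ("By Gordon's Lemma this is equivalent to the semi-group `N(X)` being finitely generated")]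
[cite: Schrijver1986, §16.4 Thm. 16.4] -/
theorem exists_finset_addSubmonoidClosure_eq_of_span_nnreal_eq {S : Finset (E [⋀^Fin 2]→L[ℝ] ℝ)}
    (hS : ∀ η ∈ S, IsNSForm Φ η)
    (hnef : (Submodule.span ℝ≥0 (S : Set (E [⋀^Fin 2]→L[ℝ] ℝ)) : Set (E [⋀^Fin 2]→L[ℝ] ℝ)) =
      {θ | θ ∈ Submodule.span ℝ {η : E [⋀^Fin 2]→L[ℝ] ℝ | IsNSForm Φ η} ∧ ∀ v : E, 0 ≤ θ ![I • v, v]}) :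
    ∃ G : Finset (E [⋀^Fin 2]→L[ℝ] ℝ),
      (AddSubmonoid.closure (G : Set (E [⋀^Fin 2]→L[ℝ] ℝ)) : Set (E [⋀^Fin 2]→L[ℝ] ℝ)) =
        {η | IsNSForm Φ η ∧ ∀ v : E, 0 ≤ η ![I • v, v]} := by
  classical
  haveI := moduleFree_neronSeveriGroup Φ
  haveI := moduleFinite_neronSeveriGroup Φ
  set n := finrank ℤ (neronSeveriGroup Φ) with hn
  let b : Basis (Fin n) ℤ (neronSeveriGroup Φ) := Module.finBasis ℤ (neronSeveriGroup Φ)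
  -- the generators as elements of `NS(X)`
  let B : (E [⋀^Fin 2]→L[ℝ] ℝ) → neronSeveriGroup Φ := fun x ↦
    if hx : IsNSForm Φ x then ⟨x, hx⟩ else 0
  have hB : ∀ s ∈ S, ((B s : neronSeveriGroup Φ) : E [⋀^Fin 2]→L[ℝ] ℝ) = s := fun s hs ↦ by
    simp only [B, dif_pos (hS s hs)]
  -- the lattice points of the parallelepiped
  set P : Set (neronSeveriGroup Φ) := {p | ∃ μ : (E [⋀^Fin 2]→L[ℝ] ℝ) → ℝ,
    (∀ s ∈ S, 0 ≤ μ s ∧ μ s ≤ 1) ∧ (p : E [⋀^Fin 2]→L[ℝ] ℝ) = ∑ s ∈ S, μ s • s} with hP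
  have hPfin : P.Finite := by
    let R : Fin n → ℤ := fun j ↦ ∑ s ∈ S, |b.equivFun (B s) j|
    have hbox : (Set.univ.pi fun j : Fin n ↦ Set.Icc (-R j) (R j)).Finite :=
      Set.Finite.pi fun j ↦ Set.finite_Icc _ _
    refine (hbox.preimage (b.equivFun.injective.injOn)).subset fun p hp ↦ ?_
    obtain ⟨μ, hμ, hpμ⟩ := hp
    rw [Set.mem_preimage, Set.mem_univ_pi]
    intro j
    have h := abs_equivFun_le_of_eq_sum_smul Φ b S B hB (μ := μ)
      (fun s hs ↦ abs_le.2 ⟨by linarith [(hμ s hs).1], (hμ s hs).2⟩) hpμ j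
    exact ⟨(abs_le.1 h).1, (abs_le.1 h).2⟩
  -- semipositivity of the generators
  have hSpsd : ∀ s ∈ S, ∀ v : E, 0 ≤ s ![I • v, v] := fun s hs ↦ by
    have h : s ∈ (Submodule.span ℝ≥0 (S : Set (E [⋀^Fin 2]→L[ℝ] ℝ)) : Set (E [⋀^Fin 2]→L[ℝ] ℝ)) :=
      Submodule.subset_span hs
    rw [hnef] at h
    exact h.2
  refine ⟨hPfin.toFinset.image (fun p : neronSeveriGroup Φ ↦ (p : E [⋀^Fin 2]→L[ℝ] ℝ)) ∪ S,
    Set.Subset.antisymm ?_ ?_⟩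
  · -- the generators are effective classes, which form a submonoid
    have hle : AddSubmonoid.closure
        ((hPfin.toFinset.image (fun p : neronSeveriGroup Φ ↦ (p : E [⋀^Fin 2]→L[ℝ] ℝ)) ∪ S : Finset _) :
          Set (E [⋀^Fin 2]→L[ℝ] ℝ)) ≤
        ((neronSeveriGroup Φ).toAddSubmonoid ⊓
          { carrier := {a | ∀ v : E, 0 ≤ a ![I • v, v]}
            add_mem' := fun {a a'} ha ha' v ↦ by
              rw [ContinuousAlternatingMap.add_apply]
              exact add_nonneg (ha v) (ha' v)
            zero_mem' := fun v ↦ by rw [ContinuousAlternatingMap.coe_zero, Pi.zero_apply] }) := by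
      refine AddSubmonoid.closure_le.2 fun a ha ↦ ?_
      rw [Finset.coe_union, Finset.coe_image] at ha
      rcases ha with ⟨p, hp, rfl⟩ | ha
      · refine ⟨p.2, fun v ↦ ?_⟩
        rw [Finset.mem_coe, Set.Finite.mem_toFinset] at hp
        obtain ⟨μ, hμ, hpμ⟩ := hp
        change 0 ≤ (p : E [⋀^Fin 2]→L[ℝ] ℝ) ![I • v, v]
        rw [hpμ, ContinuousAlternatingMap.sum_apply]
        exact Finset.sum_nonneg fun s hs ↦ by
          rw [ContinuousAlternatingMap.smul_apply, smul_eq_mul]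
          exact mul_nonneg (hμ s hs).1 (hSpsd s hs v)
      · exact ⟨hS a ha, hSpsd a ha⟩
    intro a ha
    exact ⟨(hle ha).1, (hle ha).2⟩
  · -- an effective class is `Σ ⌊λ_s⌋ s` plus a lattice point of the parallelepiped
    rintro η ⟨hη, hpsd⟩
    have hmem : η ∈ (Submodule.span ℝ≥0 (S : Set (E [⋀^Fin 2]→L[ℝ] ℝ)) : Set (E [⋀^Fin 2]→L[ℝ] ℝ)) := by
      rw [hnef]
      exact ⟨Submodule.subset_span hη, hpsd⟩
    obtain ⟨f, -, hf⟩ := Submodule.mem_span_finset.1 hmem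
    -- integer and fractional parts of the coefficients
    set N : (E [⋀^Fin 2]→L[ℝ] ℝ) → ℕ := fun s ↦ ⌊(f s : ℝ)⌋₊ with hN
    set μ : (E [⋀^Fin 2]→L[ℝ] ℝ) → ℝ := fun s ↦ (f s : ℝ) - N s with hμdef
    have hμ : ∀ s ∈ S, 0 ≤ μ s ∧ μ s ≤ 1 := fun s _ ↦ by
      have h0 : (0 : ℝ) ≤ f s := (f s).2
      refine ⟨sub_nonneg.2 (Nat.floor_le h0), ?_⟩
      have := Nat.lt_floor_add_one (f s : ℝ)
      simp only [hμdef, hN]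
      linarith
    have hηeq : η = (∑ s ∈ S, N s • s) + ∑ s ∈ S, μ s • s := by
      rw [← hf, ← Finset.sum_add_distrib]
      refine Finset.sum_congr rfl fun s _ ↦ ?_
      rw [NNReal.smul_def, ← Nat.cast_smul_eq_nsmul ℝ (N s)]
      ext v
      simp only [hμdef, ContinuousAlternatingMap.add_apply, ContinuousAlternatingMap.smul_apply, smul_eq_mul]
      ring
    -- the fractional part is a class of `NS(X)` in the parallelepiped
    have hint : (∑ s ∈ S, N s • s) ∈ neronSeveriGroup Φ :=
      AddSubgroup.sum_mem _ fun s hs ↦ AddSubgroup.nsmul_mem _ (hS s hs) _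
    have hfrac : (∑ s ∈ S, μ s • s) ∈ neronSeveriGroup Φ := by
      have h : ∑ s ∈ S, μ s • s = η - ∑ s ∈ S, N s • s := by rw [hηeq]; abel
      rw [h]
      exact AddSubgroup.sub_mem _ hη hint
    have hPmem : (⟨∑ s ∈ S, μ s • s, hfrac⟩ : neronSeveriGroup Φ) ∈ P := ⟨μ, hμ, rfl⟩
    rw [hηeq]
    refine AddSubmonoid.add_mem _ (AddSubmonoid.sum_mem _ fun s hs ↦ AddSubmonoid.nsmul_mem _
      (AddSubmonoid.subset_closure ?_) _) (AddSubmonoid.subset_closure ?_)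
    · rw [Finset.coe_union]
      exact Or.inr hs
    · rw [Finset.coe_union, Finset.coe_image]
      refine Or.inl ⟨⟨∑ s ∈ S, μ s • s, hfrac⟩, ?_, rfl⟩
      rw [Finset.mem_coe, Set.Finite.mem_toFinset]
      exact hPmem

end Gordan

/-! ### §2 (ic) ⟹ (ib) for abelian varieties: nef classes are limits of ample `ℚ`-classes -/

section Density

variable {ι : Type*} [Fintype ι] {E : Type*} [NormedAddCommGroup E] [NormedSpace ℂ E]
  (Φ : (ι → ℝ) ≃L[ℝ] E)

/-- The covering space of a complex torus is finite-dimensional. [cite: Lange2023AbelianVarietiesComplex, §1.1.1] -/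
private theorem finiteDimensional_complex₅₅ (Φ : (ι → ℝ) ≃L[ℝ] E) : FiniteDimensional ℂ E := by
  haveI : FiniteDimensional ℝ E := LinearEquiv.finiteDimensional Φ.toLinearEquiv
  exact Module.Finite.of_restrictScalars_finite ℝ ℂ E

/-- **Openness of positivity along a segment, two-sided**: for `P > 0` and `η` of type `(1,1)` there is
`δ > 0` with `P + uη > 0` for all `|u| ≤ δ`. [cite: Debarre2001, §1.7 (the ample cone and its closure) and 1.28 (nef ℝ-divisors)] -/
private theorem exists_pos_forall_abs_le_pos [FiniteDimensional ℂ E] {P η : E [⋀^Fin 2]→L[ℝ] ℝ}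
    (hP : ∀ u v : E, P ![I • u, I • v] = P ![u, v]) (hPpos : ∀ v : E, v ≠ 0 → 0 < P ![I • v, v])
    (hη : ∀ u v : E, η ![I • u, I • v] = η ![u, v]) :
    ∃ δ : ℝ, 0 < δ ∧ ∀ u : ℝ, |u| ≤ δ → ∀ v : E, v ≠ 0 → 0 < (P + u • η) ![I • v, v] := by
  obtain ⟨δ₁, hδ₁, h₁⟩ := exists_pos_forall_add_smul_apply_I_smul_self_pos hP hPpos hη
  have hη' : ∀ u v : E, (-η) ![I • u, I • v] = (-η) ![u, v] := fun u v ↦ by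
    rw [ContinuousAlternatingMap.neg_apply, ContinuousAlternatingMap.neg_apply, hη]
  obtain ⟨δ₂, hδ₂, h₂⟩ := exists_pos_forall_add_smul_apply_I_smul_self_pos hP hPpos hη'
  refine ⟨min δ₁ δ₂, lt_min hδ₁ hδ₂, fun u hu v hv ↦ ?_⟩
  have hPv := hPpos v hv
  have hδ₁' : δ₁ ≠ 0 := hδ₁.ne'
  have hδ₂' : δ₂ ≠ 0 := hδ₂.ne'
  -- `P + uη` is a convex combination of `P` and `P ± δη`
  rcases le_or_gt 0 u with hu0 | hu0
  · have huδ : u ≤ δ₁ := (abs_le.1 hu).2.trans (min_le_left _ _)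
    have h₁v := h₁ v hv
    have hform : (P + u • η) ![I • v, v] =
        (u / δ₁) * (P + δ₁ • η) ![I • v, v] + (1 - u / δ₁) * P ![I • v, v] := by
      simp only [ContinuousAlternatingMap.add_apply, ContinuousAlternatingMap.smul_apply, smul_eq_mul]
      field_simp
      ring
    rw [hform]
    rcases eq_or_lt_of_le huδ with h | h
    · rw [h, div_self hδ₁.ne', one_mul, sub_self, zero_mul, add_zero]
      exact h₁v
    · have hlt : u / δ₁ < 1 := (div_lt_one hδ₁).2 h
      exact add_pos_of_nonneg_of_pos (mul_nonneg (div_nonneg hu0 hδ₁.le) h₁v.le)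
        (mul_pos (sub_pos.2 hlt) hPv)
  · have huδ : -u ≤ δ₂ := by
      have := (abs_le.1 hu).1
      have := min_le_right δ₁ δ₂
      linarith
    have h₂v := h₂ v hv
    have hform : (P + u • η) ![I • v, v] =
        ((-u) / δ₂) * (P + δ₂ • (-η)) ![I • v, v] + (1 - (-u) / δ₂) * P ![I • v, v] := by
      simp only [ContinuousAlternatingMap.add_apply, ContinuousAlternatingMap.smul_apply,
        ContinuousAlternatingMap.neg_apply, smul_eq_mul]
      field_simp
      ring
    rw [hform]
    rcases eq_or_lt_of_le huδ with h | h
    · rw [h, div_self hδ₂.ne', one_mul, sub_self, zero_mul, add_zero]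
      exact h₂v
    · have hlt : (-u) / δ₂ < 1 := (div_lt_one hδ₂).2 h
      exact add_pos_of_nonneg_of_pos (mul_nonneg (div_nonneg (by linarith) hδ₂.le) h₂v.le)
        (mul_pos (sub_pos.2 hlt) hPv)

/-- **Openness of positivity, finitely many directions**: for `P > 0` and `(1,1)`-forms `η_j` (`j ∈ κ`
finite) there is `δ > 0` with `P + Σ_j u_j η_j > 0` whenever all `|u_j| ≤ δ` (average of the positive
forms `P + |κ|u_j η_j`). [cite: Debarre2001, §1.7 (the ample cone and its closure) and 1.28 (nef ℝ-divisors)] -/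
private theorem exists_pos_forall_sum_smul_pos [FiniteDimensional ℂ E] {κ : Type*} [Fintype κ]
    {P : E [⋀^Fin 2]→L[ℝ] ℝ} {η : κ → E [⋀^Fin 2]→L[ℝ] ℝ}
    (hP : ∀ u v : E, P ![I • u, I • v] = P ![u, v]) (hPpos : ∀ v : E, v ≠ 0 → 0 < P ![I • v, v])
    (hη : ∀ j, ∀ u v : E, η j ![I • u, I • v] = η j ![u, v]) :
    ∃ δ : ℝ, 0 < δ ∧ ∀ u : κ → ℝ, (∀ j, |u j| ≤ δ) →
      ∀ v : E, v ≠ 0 → 0 < (P + ∑ j, u j • η j) ![I • v, v] := by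
  classical
  rcases isEmpty_or_nonempty κ with hκ | hκ
  · refine ⟨1, one_pos, fun u _ v hv ↦ ?_⟩
    rw [Finset.univ_eq_empty, Finset.sum_empty, add_zero]
    exact hPpos v hv
  choose δ hδ hδpos using fun j ↦ exists_pos_forall_abs_le_pos hP hPpos (hη j)
  obtain ⟨j₀, -, hj₀⟩ := Finset.exists_min_image Finset.univ δ Finset.univ_nonempty
  have hk : (0 : ℝ) < Fintype.card κ := by exact_mod_cast Fintype.card_pos
  have hk' : (Fintype.card κ : ℝ) ≠ 0 := hk.ne'
  refine ⟨δ j₀ / Fintype.card κ, div_pos (hδ j₀) hk, fun u hu v hv ↦ ?_⟩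
  -- `k · (P + Σ u_j η_j) = Σ_j (P + (k u_j) η_j)`, a sum of positive forms
  have hsum : (Fintype.card κ : ℝ) * (P + ∑ j, u j • η j) ![I • v, v] =
      ∑ j, (P + ((Fintype.card κ : ℝ) * u j) • η j) ![I • v, v] := by
    simp only [ContinuousAlternatingMap.add_apply, ContinuousAlternatingMap.sum_apply,
      ContinuousAlternatingMap.smul_apply, smul_eq_mul, mul_add, Finset.mul_sum, Finset.sum_add_distrib,
      Finset.sum_const, Finset.card_univ, nsmul_eq_mul, mul_assoc]
  have hterm : ∀ j, 0 < (P + ((Fintype.card κ : ℝ) * u j) • η j) ![I • v, v] := fun j ↦ by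
    refine hδpos j _ ?_ v hv
    rw [abs_mul, abs_of_pos hk]
    calc (Fintype.card κ : ℝ) * |u j| ≤ Fintype.card κ * (δ j₀ / Fintype.card κ) :=
          mul_le_mul_of_nonneg_left (hu j) hk.le
      _ = δ j₀ := by field_simp
      _ ≤ δ j := hj₀ j (Finset.mem_univ j)
  have hpos : 0 < (Fintype.card κ : ℝ) * (P + ∑ j, u j • η j) ![I • v, v] := by
    rw [hsum]
    exact Finset.sum_pos (fun j _ ↦ hterm j) Finset.univ_nonempty
  exact (mul_pos_iff_of_pos_left hk).1 hpos

/-- **A nef class is a limit of ample `ℚ`-classes** (Debarre 1.28 on an abelian variety): for `θ` in the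
nef cone `{θ ∈ NS_ℝ(X) | H_θ ≥ 0}` and `ε > 0` there is a POSITIVE class `q ∈ NS_ℚ(X)` (`H_q > 0`, an ample
`ℚ`-class) with `‖θ − q‖ < ε` — namely `q = Σ_j r_j b_j + tM` for a `ℤ`-basis `(b_j)` of `NS(X)`,
`θ = Σ c_j b_j`, rationals `r_j` near `c_j`, a small rational `t > 0` and an ample `M` (`θ + tM > 0`, and
positivity is an open condition). [cite: Debarre2001, §1.7 (the ample cone and its closure) and 1.28 (nef ℝ-divisors)]
[cite: Bauer1998ConeOfCurves, §4 ((ic) ⟺ (ib), "elementary properties of cones")] -/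
theorem IsAbelianVariety.exists_mem_span_rat_forall_pos_dist_lt (hX : IsAbelianVariety Φ)
    {θ : E [⋀^Fin 2]→L[ℝ] ℝ} (hθ : θ ∈ Submodule.span ℝ {η : E [⋀^Fin 2]→L[ℝ] ℝ | IsNSForm Φ η})
    (hθpsd : ∀ v : E, 0 ≤ θ ![I • v, v]) {ε : ℝ} (hε : 0 < ε) :
    ∃ q : E [⋀^Fin 2]→L[ℝ] ℝ, q ∈ Submodule.span ℚ {η : E [⋀^Fin 2]→L[ℝ] ℝ | IsNSForm Φ η} ∧
      (∀ v : E, v ≠ 0 → 0 < q ![I • v, v]) ∧ dist θ q < ε := by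
  classical
  haveI : FiniteDimensional ℝ E := LinearEquiv.finiteDimensional Φ.toLinearEquiv
  haveI : FiniteDimensional ℂ E := finiteDimensional_complex₅₅ Φ
  haveI := moduleFree_neronSeveriGroup Φ
  haveI := moduleFinite_neronSeveriGroup Φ
  obtain ⟨M, hM⟩ := hX
  set n := finrank ℤ (neronSeveriGroup Φ) with hn
  let b : Basis (Fin n) ℤ (neronSeveriGroup Φ) := Module.finBasis ℤ (neronSeveriGroup Φ)
  -- `θ = Σ_j c_j b_j`
  have hθspan : θ ∈ Submodule.span ℝ (Set.range fun j : Fin n ↦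
      ((b j : neronSeveriGroup Φ) : E [⋀^Fin 2]→L[ℝ] ℝ)) := by
    have hle : Submodule.span ℝ {η : E [⋀^Fin 2]→L[ℝ] ℝ | IsNSForm Φ η} ≤
        Submodule.span ℝ (Set.range fun j : Fin n ↦ ((b j : neronSeveriGroup Φ) : E [⋀^Fin 2]→L[ℝ] ℝ)) := by
      refine Submodule.span_le.2 fun η hη ↦ ?_
      change ((⟨η, hη⟩ : neronSeveriGroup Φ) : E [⋀^Fin 2]→L[ℝ] ℝ) ∈
        (Submodule.span ℝ (Set.range fun j : Fin n ↦ ((b j : neronSeveriGroup Φ) : E [⋀^Fin 2]→L[ℝ] ℝ)) :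
          Set (E [⋀^Fin 2]→L[ℝ] ℝ))
      rw [coe_eq_sum_equivFun_smul Φ b ⟨η, hη⟩]
      exact Submodule.sum_mem _ fun j _ ↦ Submodule.smul_mem _ _ (Submodule.subset_span ⟨j, rfl⟩)
    exact hle hθ
  obtain ⟨c, hc⟩ := (Submodule.mem_span_range_iff_exists_fun ℝ).1 hθspan
  -- the error budget
  set C : ℝ := ‖M‖ + ∑ j, ‖((b j : neronSeveriGroup Φ) : E [⋀^Fin 2]→L[ℝ] ℝ)‖ + 1 with hC
  have hCpos : 0 < C := by
    have h1 : 0 ≤ ‖M‖ := norm_nonneg _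
    have h2 : 0 ≤ ∑ j, ‖((b j : neronSeveriGroup Φ) : E [⋀^Fin 2]→L[ℝ] ℝ)‖ :=
      Finset.sum_nonneg fun j _ ↦ norm_nonneg _
    linarith
  set ε' : ℝ := ε / (2 * C) with hε'
  have hε'pos : 0 < ε' := div_pos hε (by linarith)
  -- a small rational `t > 0` and the positive form `P = θ + tM`
  obtain ⟨t, ht0, htε⟩ := exists_rat_btwn hε'pos
  have ht0' : (0 : ℝ) < t := by exact_mod_cast ht0
  have hP11 : ∀ u v : E, (θ + (t : ℝ) • M) ![I • u, I • v] = (θ + (t : ℝ) • M) ![u, v] := fun u v ↦ by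
    rw [ContinuousAlternatingMap.add_apply, ContinuousAlternatingMap.add_apply,
      ContinuousAlternatingMap.smul_apply, ContinuousAlternatingMap.smul_apply,
      type_one_one_of_mem_span_isNSForm Φ hθ, hM.1]
  have hPpos : ∀ v : E, v ≠ 0 → 0 < (θ + (t : ℝ) • M) ![I • v, v] := fun v hv ↦ by
    rw [ContinuousAlternatingMap.add_apply, ContinuousAlternatingMap.smul_apply, smul_eq_mul]
    exact add_pos_of_nonneg_of_pos (hθpsd v) (mul_pos ht0' (hM.2.2 v hv))
  obtain ⟨δ, hδ, hδpos⟩ := exists_pos_forall_sum_smul_pos (κ := Fin n)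
    (η := fun j ↦ ((b j : neronSeveriGroup Φ) : E [⋀^Fin 2]→L[ℝ] ℝ)) hP11 hPpos
    (fun j ↦ ((mem_neronSeveriGroup_iff Φ).1 (b j).2).type_one_one)
  -- rational coefficients `r_j` near `c_j`
  have hr : ∀ j : Fin n, ∃ r : ℚ, |(r : ℝ) - c j| ≤ min δ ε' := fun j ↦ by
    have hm : 0 < min δ ε' := lt_min hδ hε'pos
    obtain ⟨r, hr₁, hr₂⟩ := exists_rat_btwn (show c j - min δ ε' < c j + min δ ε' by linarith)
    exact ⟨r, abs_le.2 ⟨by linarith, by linarith⟩⟩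
  choose r hr using hr
  -- the ample `ℚ`-class `q = Σ r_j b_j + tM`
  set q : E [⋀^Fin 2]→L[ℝ] ℝ := ∑ j, (r j : ℝ) • ((b j : neronSeveriGroup Φ) : E [⋀^Fin 2]→L[ℝ] ℝ) +
    (t : ℝ) • M with hq
  have hqP : q = (θ + (t : ℝ) • M) + ∑ j, ((r j : ℝ) - c j) • ((b j : neronSeveriGroup Φ) : E [⋀^Fin 2]→L[ℝ] ℝ) := by
    ext v
    simp only [hq, ← hc, ContinuousAlternatingMap.add_apply, ContinuousAlternatingMap.sum_apply,
      ContinuousAlternatingMap.smul_apply, smul_eq_mul, sub_mul, Finset.sum_sub_distrib]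
    ring
  have hqpos : ∀ v : E, v ≠ 0 → 0 < q ![I • v, v] := fun v hv ↦ by
    rw [hqP]
    exact hδpos _ (fun j ↦ (hr j).trans (min_le_left _ _)) v hv
  have hqrat : q ∈ Submodule.span ℚ {η : E [⋀^Fin 2]→L[ℝ] ℝ | IsNSForm Φ η} := by
    rw [hq]
    refine Submodule.add_mem _ (Submodule.sum_mem _ fun j _ ↦ ?_) ?_
    · rw [Rat.cast_smul_eq_qsmul ℝ]
      exact Submodule.smul_mem _ _ (Submodule.subset_span ((mem_neronSeveriGroup_iff Φ).1 (b j).2))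
    · rw [Rat.cast_smul_eq_qsmul ℝ]
      exact Submodule.smul_mem _ _ (Submodule.subset_span (hM.isNSForm Φ))
  refine ⟨q, hqrat, hqpos, ?_⟩
  -- `‖θ − q‖ ≤ t‖M‖ + Σ |r_j − c_j| ‖b_j‖ < ε`
  have hdiff : θ - q = -((t : ℝ) • M + ∑ j, ((r j : ℝ) - c j) • ((b j : neronSeveriGroup Φ) : E [⋀^Fin 2]→L[ℝ] ℝ)) := by
    rw [hqP]
    abel
  rw [dist_eq_norm, hdiff, norm_neg]
  calc ‖(t : ℝ) • M + ∑ j, ((r j : ℝ) - c j) • ((b j : neronSeveriGroup Φ) : E [⋀^Fin 2]→L[ℝ] ℝ)‖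
      ≤ ‖(t : ℝ) • M‖ + ∑ j, ‖((r j : ℝ) - c j) • ((b j : neronSeveriGroup Φ) : E [⋀^Fin 2]→L[ℝ] ℝ)‖ :=
        (norm_add_le _ _).trans (add_le_add le_rfl (norm_sum_le _ _))
    _ ≤ ε' * ‖M‖ + ∑ j, ε' * ‖((b j : neronSeveriGroup Φ) : E [⋀^Fin 2]→L[ℝ] ℝ)‖ := by
        refine add_le_add ?_ (Finset.sum_le_sum fun j _ ↦ ?_)
        · rw [norm_smul, Real.norm_eq_abs, abs_of_pos ht0']
          exact mul_le_mul_of_nonneg_right htε.le (norm_nonneg _)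
        · rw [norm_smul, Real.norm_eq_abs]
          exact mul_le_mul_of_nonneg_right ((hr j).trans (min_le_right _ _)) (norm_nonneg _)
    _ = ε' * (‖M‖ + ∑ j, ‖((b j : neronSeveriGroup Φ) : E [⋀^Fin 2]→L[ℝ] ℝ)‖) := by
        rw [mul_add, Finset.mul_sum]
    _ < ε := by
        have hle : ‖M‖ + ∑ j, ‖((b j : neronSeveriGroup Φ) : E [⋀^Fin 2]→L[ℝ] ℝ)‖ ≤ C := by
          rw [hC]; linarith
        calc ε' * (‖M‖ + ∑ j, ‖((b j : neronSeveriGroup Φ) : E [⋀^Fin 2]→L[ℝ] ℝ)‖)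
            ≤ ε' * C := mul_le_mul_of_nonneg_left hle hε'pos.le
          _ = ε / 2 := by rw [hε', div_mul_eq_mul_div, mul_div_mul_right _ _ hCpos.ne']
          _ < ε := by linarith
/-- **(ic) ⟹ (ib) — on an abelian variety a nef class is a limit of ample `ℚ`-classes**: if the semigroup
`N(X)` of effective classes is generated by the finite set `S`, then the nef cone
`Nef(X) = {θ ∈ NS_ℝ(X) | H_θ ≥ 0}` is the (rational polyhedral) convex cone generated by `S ∖ {0}`. Indeed
for `θ` nef, `M` ample and a `ℤ`-basis `(b_j)` of `NS(X)`, `θ = Σ c_j b_j`, the classes `Σ r_j b_j + tM`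
with `r_j ∈ ℚ` near `c_j` and small rational `t > 0` are positive (`θ + tM > 0` and positivity is open), lie
in `NS_ℚ(X)`, so have a multiple in `N(X) ⊆ Σ ℝ≥0·s`, and converge to `θ`; and a finitely generated cone of
semi-positive classes is closed. [cite: Bauer1998ConeOfCurves, §4 ((ic) ⟺ (ib), "elementary properties of cones")]
[cite: Debarre2001, §1.7 (the ample cone and its closure) and 1.28 (nef ℝ-divisors)] -/
theorem IsAbelianVariety.exists_finset_span_nnreal_eq_of_addSubmonoidClosure_eq (hX : IsAbelianVariety Φ)
    {S : Finset (E [⋀^Fin 2]→L[ℝ] ℝ)}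
    (hgen : (AddSubmonoid.closure (S : Set (E [⋀^Fin 2]→L[ℝ] ℝ)) : Set (E [⋀^Fin 2]→L[ℝ] ℝ)) =
      {η | IsNSForm Φ η ∧ ∀ v : E, 0 ≤ η ![I • v, v]}) :
    ∃ S' : Finset (E [⋀^Fin 2]→L[ℝ] ℝ), (∀ η ∈ S', IsNSForm Φ η) ∧
      (Submodule.span ℝ≥0 (S' : Set (E [⋀^Fin 2]→L[ℝ] ℝ)) : Set (E [⋀^Fin 2]→L[ℝ] ℝ)) =
        {θ | θ ∈ Submodule.span ℝ {η : E [⋀^Fin 2]→L[ℝ] ℝ | IsNSForm Φ η} ∧ ∀ v : E, 0 ≤ θ ![I • v, v]} := by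
  classical
  haveI : FiniteDimensional ℝ E := LinearEquiv.finiteDimensional Φ.toLinearEquiv
  -- the generators are effective classes
  have hSN : ∀ s ∈ S, IsNSForm Φ s ∧ ∀ v : E, 0 ≤ s ![I • v, v] := fun s hs ↦ by
    have h : s ∈ (AddSubmonoid.closure (S : Set (E [⋀^Fin 2]→L[ℝ] ℝ)) : Set (E [⋀^Fin 2]→L[ℝ] ℝ)) :=
      AddSubmonoid.subset_closure hs
    rw [hgen] at h
    exact h
  refine ⟨S.erase 0, fun η hη ↦ (hSN η (Finset.mem_of_mem_erase hη)).1, ?_⟩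
  -- the cone generated by `S ∖ 0` is closed
  have hclosed : IsClosed (Submodule.span ℝ≥0 ((S.erase 0 : Finset _) : Set (E [⋀^Fin 2]→L[ℝ] ℝ)) :
      Set (E [⋀^Fin 2]→L[ℝ] ℝ)) :=
    isClosed_span_nnreal_of_forall_semipos (S.erase 0).finite_toSet
      (fun η hη ↦ (hSN η (Finset.mem_of_mem_erase hη)).1.type_one_one)
      (fun η hη ↦ (hSN η (Finset.mem_of_mem_erase hη)).2)
      (fun h ↦ (Finset.mem_erase.1 (Finset.mem_coe.1 h)).1 rfl)
  -- `N(X) ⊆ Σ ℝ≥0·s`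
  have hNle : ∀ η : E [⋀^Fin 2]→L[ℝ] ℝ, IsNSForm Φ η → (∀ v : E, 0 ≤ η ![I • v, v]) →
      η ∈ Submodule.span ℝ≥0 ((S.erase 0 : Finset _) : Set (E [⋀^Fin 2]→L[ℝ] ℝ)) := by
    intro η hη hpsd
    have hmem : η ∈ (AddSubmonoid.closure (S : Set (E [⋀^Fin 2]→L[ℝ] ℝ)) : Set (E [⋀^Fin 2]→L[ℝ] ℝ)) := by
      rw [hgen]
      exact ⟨hη, hpsd⟩
    have hle : AddSubmonoid.closure (S : Set (E [⋀^Fin 2]→L[ℝ] ℝ)) ≤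
        (Submodule.span ℝ≥0 ((S.erase 0 : Finset _) : Set (E [⋀^Fin 2]→L[ℝ] ℝ))).toAddSubmonoid := by
      refine AddSubmonoid.closure_le.2 fun s hs ↦ ?_
      by_cases h0 : s = 0
      · rw [h0]
        exact (Submodule.span ℝ≥0 _).zero_mem
      · exact Submodule.subset_span (Finset.mem_coe.2 (Finset.mem_erase.2 ⟨h0, hs⟩))
    exact hle hmem
  refine Set.Subset.antisymm ?_ ?_
  · -- generators are nef, nef classes form a convex cone
    have hle : Submodule.span ℝ≥0 ((S.erase 0 : Finset _) : Set (E [⋀^Fin 2]→L[ℝ] ℝ)) ≤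
        { carrier := {θ | θ ∈ Submodule.span ℝ {η : E [⋀^Fin 2]→L[ℝ] ℝ | IsNSForm Φ η} ∧
            ∀ v : E, 0 ≤ θ ![I • v, v]}
          add_mem' := fun {a a'} ha ha' ↦ ⟨Submodule.add_mem _ ha.1 ha'.1, fun v ↦ by
            rw [ContinuousAlternatingMap.add_apply]
            exact add_nonneg (ha.2 v) (ha'.2 v)⟩
          zero_mem' := ⟨Submodule.zero_mem _, fun v ↦ by
            rw [ContinuousAlternatingMap.coe_zero, Pi.zero_apply]⟩
          smul_mem' := fun c a ha ↦ ⟨by rw [NNReal.smul_def]; exact Submodule.smul_mem _ _ ha.1, fun v ↦ by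
            rw [ContinuousAlternatingMap.smul_apply, NNReal.smul_def, smul_eq_mul]
            exact mul_nonneg c.2 (ha.2 v)⟩ } := by
      refine Submodule.span_le.2 fun s hs ↦ ?_
      have hs' := hSN s (Finset.mem_of_mem_erase hs)
      exact ⟨Submodule.subset_span hs'.1, hs'.2⟩
    intro θ hθ
    exact hle hθ
  · -- a nef class is a limit of ample `ℚ`-classes, whose multiples are effective classes
    rintro θ ⟨hθ, hθpsd⟩
    rw [← hclosed.closure_eq, Metric.mem_closure_iff]
    intro ε hε
    obtain ⟨q, hqrat, hqpos, hdist⟩ := hX.exists_mem_span_rat_forall_pos_dist_lt Φ hθ hθpsd hε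
    obtain ⟨m, hm, hmq⟩ := exists_pos_isNSForm_nat_cast_smul_of_mem_span_rat Φ hqrat
    have hqpsd : ∀ v : E, 0 ≤ q ![I • v, v] := fun v ↦ by
      by_cases hv : v = 0
      · simp only [hv, smul_zero, twoForm_self, le_refl]
      · exact (hqpos v hv).le
    have hmqpsd : ∀ v : E, 0 ≤ ((m : ℝ) • q) ![I • v, v] := fun v ↦ by
      rw [ContinuousAlternatingMap.smul_apply, smul_eq_mul]
      exact mul_nonneg (Nat.cast_nonneg m) (hqpsd v)
    have hqmem : q ∈ Submodule.span ℝ≥0 ((S.erase 0 : Finset _) : Set (E [⋀^Fin 2]→L[ℝ] ℝ)) := by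
      have h := Submodule.smul_mem _ ((m : ℝ≥0)⁻¹) (hNle _ hmq hmqpsd)
      have hm' : (m : ℝ) ≠ 0 := by exact_mod_cast hm.ne'
      rwa [NNReal.smul_def, NNReal.coe_inv, NNReal.coe_natCast, smul_smul, inv_mul_cancel₀ hm', one_smul] at h
    exact ⟨q, hqmem, hdist⟩

/-- **Bauer: "(ib) the nef cone is rational polyhedral ⟺ (ic) the semi-group `N(X)` is finitely
generated", for every complex abelian variety** (Gordan's lemma, §1, and the density of ample `ℚ`-classes,
§2). [cite: Bauer1998ConeOfCurves, §1 Theorem ((ib) ⟺ (ic)) and §4 ("By Gordon's Lemma …")] -/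
theorem IsAbelianVariety.exists_finset_span_nnreal_eq_iff_exists_finset_addSubmonoidClosure_eq
    (hX : IsAbelianVariety Φ) :
    (∃ S : Finset (E [⋀^Fin 2]→L[ℝ] ℝ), (∀ η ∈ S, IsNSForm Φ η) ∧
        (Submodule.span ℝ≥0 (S : Set (E [⋀^Fin 2]→L[ℝ] ℝ)) : Set (E [⋀^Fin 2]→L[ℝ] ℝ)) =
          {θ | θ ∈ Submodule.span ℝ {η : E [⋀^Fin 2]→L[ℝ] ℝ | IsNSForm Φ η} ∧ ∀ v : E, 0 ≤ θ ![I • v, v]}) ↔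
      ∃ S : Finset (E [⋀^Fin 2]→L[ℝ] ℝ),
        (AddSubmonoid.closure (S : Set (E [⋀^Fin 2]→L[ℝ] ℝ)) : Set (E [⋀^Fin 2]→L[ℝ] ℝ)) =
          {η | IsNSForm Φ η ∧ ∀ v : E, 0 ≤ η ![I • v, v]} :=
  ⟨fun ⟨_, hS, hnef⟩ ↦ exists_finset_addSubmonoidClosure_eq_of_span_nnreal_eq Φ hS hnef,
    fun ⟨_, hgen⟩ ↦ hX.exists_finset_span_nnreal_eq_of_addSubmonoidClosure_eq Φ hgen⟩

omit [Fintype ι] in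
/-- The real `2`-forms on a finite-dimensional space form a finite-dimensional space. [folklore] -/
private theorem finiteDimensional_forms₅₅ [FiniteDimensional ℝ E] : FiniteDimensional ℝ (E [⋀^Fin 2]→L[ℝ] ℝ) :=
  Module.Finite.of_injective
    ((ContinuousMultilinearMap.toMultilinearMapLinear (R' := ℝ)).comp
      (ContinuousAlternatingMap.toContinuousMultilinearMapLinear (R := ℝ)))
    (ContinuousMultilinearMap.toMultilinearMap_injective.comp
      ContinuousAlternatingMap.toContinuousMultilinearMap_injective)

omit [Fintype ι] in
/-- `NS_ℚ(X) ⊆ NS_ℝ(X)`. [folklore] -/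
private theorem span_rat_subset_span_real :
    (Submodule.span ℚ {η : E [⋀^Fin 2]→L[ℝ] ℝ | IsNSForm Φ η} : Set (E [⋀^Fin 2]→L[ℝ] ℝ)) ⊆
      (Submodule.span ℝ {η : E [⋀^Fin 2]→L[ℝ] ℝ | IsNSForm Φ η} : Set (E [⋀^Fin 2]→L[ℝ] ℝ)) := by
  intro q hq
  induction hq using Submodule.span_induction with
  | mem η hη => exact Submodule.subset_span hη
  | zero => exact Submodule.zero_mem _
  | add x y _ _ hx hy => exact Submodule.add_mem _ hx hy
  | smul c x _ hx =>
    change c • x ∈ Submodule.span ℝ {η : E [⋀^Fin 2]→L[ℝ] ℝ | IsNSForm Φ η}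
    rw [← Rat.cast_smul_eq_qsmul ℝ c x]
    exact Submodule.smul_mem _ _ hx

/-- **The nef cone is the closure of the ample `ℚ`-classes** (Kleiman; Debarre 1.28): on an abelian
variety, `Nef(X) = {θ ∈ NS_ℝ(X) | H_θ ≥ 0}` is the closure of the set of positive classes of
`NS_ℚ(X) = NS(X) ⊗ ℚ` — nef classes are limits of ample `ℚ`-classes
(`exists_mem_span_rat_forall_pos_dist_lt`), and the nef cone is closed (`NS_ℝ(X)` is a finite-dimensional,
hence closed, subspace and `H_θ(v, v) ≥ 0` are closed conditions). [cite: Debarre2001, §1.7 (the ample cone and its closure) and 1.28 (nef ℝ-divisors)] -/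
theorem IsAbelianVariety.setOf_nef_eq_closure_setOf_pos_mem_span_rat (hX : IsAbelianVariety Φ) :
    {θ : E [⋀^Fin 2]→L[ℝ] ℝ | θ ∈ Submodule.span ℝ {η : E [⋀^Fin 2]→L[ℝ] ℝ | IsNSForm Φ η} ∧
        ∀ v : E, 0 ≤ θ ![I • v, v]} =
      closure {q : E [⋀^Fin 2]→L[ℝ] ℝ | q ∈ Submodule.span ℚ {η : E [⋀^Fin 2]→L[ℝ] ℝ | IsNSForm Φ η} ∧
        ∀ v : E, v ≠ 0 → 0 < q ![I • v, v]} := by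
  haveI : FiniteDimensional ℝ E := LinearEquiv.finiteDimensional Φ.toLinearEquiv
  haveI : FiniteDimensional ℝ (E [⋀^Fin 2]→L[ℝ] ℝ) := finiteDimensional_forms₅₅
  refine Set.Subset.antisymm ?_ (closure_minimal ?_ ?_)
  · rintro θ ⟨hθ, hθpsd⟩
    rw [Metric.mem_closure_iff]
    intro ε hε
    obtain ⟨q, hqrat, hqpos, hdist⟩ := hX.exists_mem_span_rat_forall_pos_dist_lt Φ hθ hθpsd hε
    exact ⟨q, ⟨hqrat, hqpos⟩, hdist⟩
  · rintro q ⟨hqrat, hqpos⟩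
    refine ⟨span_rat_subset_span_real Φ hqrat, fun v ↦ ?_⟩
    by_cases hv : v = 0
    · simp only [hv, smul_zero, twoForm_self, le_refl]
    · exact (hqpos v hv).le
  · -- the nef cone is closed
    have h₁ : IsClosed (Submodule.span ℝ {η : E [⋀^Fin 2]→L[ℝ] ℝ | IsNSForm Φ η} : Set (E [⋀^Fin 2]→L[ℝ] ℝ)) :=
      Submodule.closed_of_finiteDimensional _
    have h₂ : IsClosed {θ : E [⋀^Fin 2]→L[ℝ] ℝ | ∀ v : E, 0 ≤ θ ![I • v, v]} := by
      rw [Set.setOf_forall]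
      refine isClosed_iInter fun v ↦ isClosed_le continuous_const ?_
      exact (ContinuousAlternatingMap.apply ℝ E ℝ ![I • v, v]).continuous
    exact h₁.inter h₂

end Density

/-! ### §3 Thm. 4.2 for the nef cone: (ib) ⟺ (ii) -/

section NefThmFourTwo

variable {ι ι' : Type*} [Fintype ι] [Fintype ι'] [DecidableEq ι] [DecidableEq ι'] {E E' : Type*}
  [NormedAddCommGroup E] [NormedSpace ℂ E] [NormedAddCommGroup E'] [NormedSpace ℂ E']
  (Φ : (ι → ℝ) ≃L[ℝ] E) (Φ' : (ι' → ℝ) ≃L[ℝ] E')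

/-- **Lemma 4.1 for the nef cone**: for isogenous abelian varieties `X ∼ X'`, `Nef(X)` is rational
polyhedral iff `Nef(X')` is ((ib) ⟺ (ic) on both sides and Lemma 4.1 for `N`, file 51).
[cite: Bauer1998ConeOfCurves, §4 Lemma 4.1 and §1 Theorem ((ib) ⟺ (ic))] -/
theorem IsIsogenous.exists_finset_span_nnreal_eq_iff (h : IsIsogenous Φ Φ') (hX : IsAbelianVariety Φ) :
    (∃ S : Finset (E [⋀^Fin 2]→L[ℝ] ℝ), (∀ η ∈ S, IsNSForm Φ η) ∧
        (Submodule.span ℝ≥0 (S : Set (E [⋀^Fin 2]→L[ℝ] ℝ)) : Set (E [⋀^Fin 2]→L[ℝ] ℝ)) =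
          {θ | θ ∈ Submodule.span ℝ {η : E [⋀^Fin 2]→L[ℝ] ℝ | IsNSForm Φ η} ∧ ∀ v : E, 0 ≤ θ ![I • v, v]}) ↔
      ∃ S' : Finset (E' [⋀^Fin 2]→L[ℝ] ℝ), (∀ η ∈ S', IsNSForm Φ' η) ∧
        (Submodule.span ℝ≥0 (S' : Set (E' [⋀^Fin 2]→L[ℝ] ℝ)) : Set (E' [⋀^Fin 2]→L[ℝ] ℝ)) =
          {θ | θ ∈ Submodule.span ℝ {η : E' [⋀^Fin 2]→L[ℝ] ℝ | IsNSForm Φ' η} ∧ ∀ w : E', 0 ≤ θ ![I • w, w]} := by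
  rw [hX.exists_finset_span_nnreal_eq_iff_exists_finset_addSubmonoidClosure_eq Φ,
    (h.isAbelianVariety_iff.1 hX).exists_finset_span_nnreal_eq_iff_exists_finset_addSubmonoidClosure_eq Φ',
    h.exists_finset_addSubmonoidClosure_eq_iff Φ Φ']

variable {κ : Type*} [Fintype κ] [DecidableEq κ] {σ : κ → Type*} [∀ k, Fintype (σ k)]
  [∀ k, DecidableEq (σ k)] {F : κ → Type*} [∀ k, NormedAddCommGroup (F k)] [∀ k, NormedSpace ℂ (F k)]
  (Ψ : ∀ k, (σ k → ℝ) ≃L[ℝ] F k)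

omit [Fintype ι'] [DecidableEq ι'] [NormedAddCommGroup E'] [NormedSpace ℂ E'] [Fintype ι] [DecidableEq ι]
  [NormedAddCommGroup E] [NormedSpace ℂ E] in
/-- **(ib) ⟺ (ii) on a product of simple factors**: for simple abelian varieties `X_k ≠ 0`, `Nef(∏_k X_k)`
is rational polyhedral iff the `X_k` are pairwise non-isogenous with `NS(X_k) ≅ ℤ`.
[cite: Bauer1998ConeOfCurves, §1 Theorem ((ib) ⟺ (ii)) and §4 Thm. 4.2] -/
theorem IsSimple.exists_finset_span_nnreal_eq_sigmaPi_iff [∀ k, Nonempty (σ k)]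
    (hS : ∀ k, IsSimple (Ψ k)) (hA : ∀ k, IsAbelianVariety (Ψ k)) :
    (∃ S : Finset ((∀ k, F k) [⋀^Fin 2]→L[ℝ] ℝ), (∀ η ∈ S, IsNSForm (sigmaPiPeriod Ψ) η) ∧
        (Submodule.span ℝ≥0 (S : Set ((∀ k, F k) [⋀^Fin 2]→L[ℝ] ℝ)) : Set ((∀ k, F k) [⋀^Fin 2]→L[ℝ] ℝ)) =
          {θ | θ ∈ Submodule.span ℝ {η : (∀ k, F k) [⋀^Fin 2]→L[ℝ] ℝ | IsNSForm (sigmaPiPeriod Ψ) η} ∧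
            ∀ v : ∀ k, F k, 0 ≤ θ ![I • v, v]}) ↔
      (∀ j k, j ≠ k → ¬ IsIsogenous (Ψ j) (Ψ k)) ∧ ∀ k, finrank ℤ (neronSeveriGroup (Ψ k)) = 1 := by
  rw [(IsAbelianVariety.sigmaPi hA).exists_finset_span_nnreal_eq_iff_exists_finset_addSubmonoidClosure_eq]
  exact IsSimple.exists_finset_addSubmonoidClosure_eq_sigmaPi_iff Ψ hS hA

variable {ρ : Type*} [Fintype ρ] [DecidableEq ρ] {τ : ρ → Type*} [∀ ν, Fintype (τ ν)] [∀ ν, DecidableEq (τ ν)]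
  {G : ρ → Type*} [∀ ν, NormedAddCommGroup (G ν)] [∀ ν, NormedSpace ℂ (G ν)]
  (X : ∀ ν, (τ ν → ℝ) ≃L[ℝ] G ν) (n : ρ → ℕ)

omit [Fintype ι'] [DecidableEq ι'] [NormedAddCommGroup E'] [NormedSpace ℂ E'] in
/-- **Bauer 1998, §1 Theorem (ib) ⟺ (ii) / Thm. 4.2 for the nef cone, as printed along a Poincaré
decomposition**: for an abelian variety `A ∼ ∏_ν X_ν^{n_ν}` with simple, nonzero, pairwise non-isogenous
`X_ν` and `n_ν ≥ 1`, the nef cone `Nef(A)` is rational polyhedral if and only if `NS(X_ν) ≅ ℤ` and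
`n_ν = 1` for every `ν`. [cite: Bauer1998ConeOfCurves, §1 Theorem ((ib) ⟺ (ii)), §4 Thm. 4.2] [cite: Lange2023AbelianVarietiesComplex, §2.4.4 Thm. 2.4.25] -/
theorem IsAbelianVariety.exists_finset_span_nnreal_eq_iff_of_isIsogenous_powers [∀ ν, Nonempty (τ ν)]
    {A : (ι → ℝ) ≃L[ℝ] E} (hAV : IsAbelianVariety A)
    (hiso : IsIsogenous A (sigmaPiPeriod fun ν ↦ powPeriod (X ν) (n ν))) (hXs : ∀ ν, IsSimple (X ν))
    (hXX : ∀ ν ν', ν ≠ ν' → ¬ IsIsogenous (X ν) (X ν')) (hn : ∀ ν, 0 < n ν) :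
    (∃ S : Finset (E [⋀^Fin 2]→L[ℝ] ℝ), (∀ η ∈ S, IsNSForm A η) ∧
        (Submodule.span ℝ≥0 (S : Set (E [⋀^Fin 2]→L[ℝ] ℝ)) : Set (E [⋀^Fin 2]→L[ℝ] ℝ)) =
          {θ | θ ∈ Submodule.span ℝ {η : E [⋀^Fin 2]→L[ℝ] ℝ | IsNSForm A η} ∧ ∀ v : E, 0 ≤ θ ![I • v, v]}) ↔
      ∀ ν, finrank ℤ (neronSeveriGroup (X ν)) = 1 ∧ n ν = 1 := by
  rw [hAV.exists_finset_span_nnreal_eq_iff_exists_finset_addSubmonoidClosure_eq A]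
  exact hAV.exists_finset_addSubmonoidClosure_eq_iff_of_isIsogenous_powers X n hiso hXs hXX hn

end NefThmFourTwo

end ComplexTorus

end Literature.Geometry.Kaehler

end
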